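import Mathlib
import Literature.MathematicalPhysics.QuantumFieldTheory.Balaban1983to89.TreeLength
import Literature.MathematicalPhysics.QuantumFieldTheory.Balaban1983to89.B12TreeDecay
import Literature.MathematicalPhysics.QuantumFieldTheory.Balaban1983to89.B13Resummation

/-!
# `Balaban1983to89.TreeLengthCubeSystem` — the CONCRETE system of localization domains of a finite window of ℤ^d with
the formalised tree length d_j := `treeLen`: the kernel discharge of the two remaining inputs of `…B12TreeDecay`
(degree bound, volume leaf) — [Balaban1988RG2Cluster] (1.26) p. 8 and (2.29) p. 18 become THEOREMS about `treeLen`,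
constants depending on the dimension only — and the CONSTRUCTION of the polymer-geometry hypothesis structure
`…B13Resummation.Geometry` (unit pv18) for this system

CITATION HEADER (lean-in-tree rule 2026-08-18).  Sources under audit: T. Bałaban, *Renormalization group approach to
lattice gauge field theories. I*, Commun. Math. Phys. **109**, 249–301 (1987) [Balaban1987RG1] (cell paper B12;
p. 257 = PDF p. 9), *II. Cluster expansions*, Commun. Math. Phys. **116**, 1–22 (1988) [Balaban1988RG2Cluster] (cell
paper B13; pp. 8, 18).  Published inputs whose mechanism the imported modules re-prove: J. Dimock, *The
renormalization group according to Balaban. I. Small fields*, Rev. Math. Phys. **25** (2013) 1330010 [Dimock2013],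
App. A Lemma 25; *II. Large fields*, J. Math. Phys. **54** (2013) 092301 [Dimock2013BalabanII], App. E Lemma E.1.
Nothing is quoted afresh in this module: every printed statement it touches is quoted verbatim in the docstrings of
the three imported modules — `…Balaban1983to89.TreeLength` (unit pv22: `treeLen`, `card_le_treeLen`),
`…Balaban1983to89.B12TreeDecay` (unit pv03: `CubeSystem`, `DegreeLE`, `VolumeLeaf`, `Ineq126Printed`,
`ineq126_of_volumeLeaf`, `ineq229_of_volumeLeaf`), `…Balaban1983to89.B13Resummation` (unit pv18: the HYPOTHESIS
structure `Geometry` of the G-B13-11 kernel, (2.11) p. 14) and, through them, `…Balaban1983to89.B13FamilySum` (unit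
pv18: `Ineq126`, `VolBound`, `Ineq227`, `Ineq229`) and `…Balaban1983to89.Setup` (`LocDomainSys`).  Cell records: GAPS.md G-B13-04 ((1.26)/(2.29)),
G-B13-07 ((2.30) lower half), G-pv03-1 (silent input `hTree` of [I] (0.26)/(0.30)), C-pv11-3, C-pv22-2; DIVERGENCE
F5 (tree geometry abstract), D-pv22.1/D-pv22.2 (conventions of `treeLen`); unit `b2b-balaban-pv22` (surge node
prover #22), journal claim G-B12TD-VOLLEAF-KERNEL.  Nothing existing is modified.

WHAT THE PAPERS PRINT (quoted in the imported modules).  [Balaban1987RG1] p. 257: the localization domains 𝐃_j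
are the connected finite families of cubes of π_j (*"two consecutive cubes have a common wall"*), d_j(X) the length
of a shortest tree graph in X meeting all its cubes.  [Balaban1988RG2Cluster] (1.26) p. 8: *"Σ_{X∈𝐃_j, X⊃□′}
exp(−κd_j(X)) ≤ O(1), (1.26) for κ sufficiently large."*; (2.29) p. 18: *"Σ_𝐃 Π_{Y∈𝐃} α₆ exp(−δκ d_k(Y)) ≤ 1.
(2.29)"* for κ sufficiently large and α₆ sufficiently small; (2.30) p. 18 (volume versus d_k).

WHAT IS PROVED HERE (kernel-checked, zero hypotheses left on the geometry).  For every dimension d and every finite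
WINDOW `B : Finset (Pt d)` of index cubes (Part 1): the localization domains inside B — the non-empty face-connected
`X ⊆ B` — form a `LocDomainSys` (`sys B`, d_j := `treeLen`, `treeLen_nonneg`) and a `B12TreeDecay.CubeSystem`
(`cubeSys B`: cubes = the elements of B, adjacency = common wall `B13ScaleTransfer.Adj`, the cubes of X = its
members, connectedness = `FaceConnected` transported to `IsRConnected`).  Part 2 — PROVED: the degree bound
`degreeLE : (cubeSys B).DegreeLE (2d)` (a cube of ℤ^d has 2d wall-neighbours) and THE VOLUME LEAF
`volumeLeaf : (cubeSys B).VolumeLeaf (4·2^d)` (from `TreeLength.card_le_treeLen`, |X| ≤ 2^d(4d_j(X) + 1) ≤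
4·2^d(1 + d_j(X))).  Part 3 — hence, by pure application of unit pv03's theorems: (1.26) `ineq126_treeLen :
(cubeSys B).Ineq126Printed κ (K₀ (4·2^d) (2d))` for every κ ≥ κ₀(4·2^d, 2d), spelled out over plain finite sets as
`sum_exp_treeLen_le` (Σ_{X ⊆ B loc. domain, X ∋ □} exp(−κ·treeLen X) ≤ K₀ for every cube □ of B); the silent input
`hTree` of [I] (0.26)/(0.30) for these covers (`hTree_treeLen`); and (2.29) `ineq229_treeLen : B13FamilySum.Ineq229
univ (cubeSys B).cubes treeLen α₆ (δκ)` under the explicit smallness conditions of `B12TreeDecay.ineq229_of_volumeLeaf`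
with c₀ = 4·2^d, Δ = 2d.  The constants κ₀(c₀, Δ) = c₀ log(2(Δ+1)²) and K₀ = e^{κ₀}(Δ+1)^{−2} of `…B12TreeDecay`
depend on d only — NOT on the window B (d = 4: c₀ = 64, Δ = 8, κ₀ = 64 log 162, `kappa₀_four`).  Part 4 — the
HYPOTHESIS structure `B13Resummation.Geometry (sys B) (Cell B)` of unit pv18's G-B13-11 kernel (its docstring: *"an
instance is to be constructed by the joiner from the concrete lattice geometry"*) IS CONSTRUCTED: `geometry B`, with
footprints `cellsOf`, the incompatibility `Touch` of (2.11) (*"Z ∩ Z′ contains a cube, or a wall of a cube"*), reach =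
cubes + wall-neighbours, ν = 2d + 1 (`card_reach_le`), κ₀ = κ₀(4·2^d, 2d), K₀ = K₀(4·2^d, 2d), c₁ = 4·2^d, and all
three inequality fields PROVED — (1.26) at rate κ₀ (Part 3), the additive volume bound (Part 2), (2.27) with its printed
constant 5 for the covering families of every domain (`ineq227_cells`, from `TreeLength.ineq227_treeLen`).  Hence
`B13Resummation.cammarotaStepWith_of_KP S c ℓ (geometry B)` — for step data whose 𝐃_{k+1} is `sys B` — keeps only
its analytic hypotheses `SpRestr`, `Repr213` and the numerical smallness conditions on (κ, ε₁, A₂).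

WHAT IS *NOT* CLAIMED.  (i) The papers' cubes live on a (large, finite) TORUS; here the window is a finite subset of
ℤ^d with free boundary (no wrap-around adjacency) — the index model of `…B13ScaleTransfer` (cell DIVERGENCE, unit
pv11) — so the catalogue "𝐃_j" here is {X ⊆ B non-empty face-connected}; a periodic window is not modelled.  (ii)
`treeLen` carries the conventions D-pv22.1 (connected polygonal graphs, sup metric, closed unit cubes).  (iii) The
numerical size of K₀ (e^{κ₀}, κ₀ = 64 log 162 at d = 4) is what the explicit animal bound gives; the printed remark
*"The number O(1) is in fact small"* is the business of `B12TreeDecay` §7, not of this module.  (iv) The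
`B12.Construction`-level corollary `B12TreeDecay.uvStable030_of_thm1_of_volumeLeaf` still needs its cube/site-count
inputs `hπ`, `hSites`; only its inputs `hΔ`, `hV` are supplied here (for windows).  (v) `B13.StepData.Dk1` is
abstract: `geometry B` serves step data built with 𝐃_{k+1} := `sys B` (a joiner's choice), nothing is asserted about
other carriers.  Value = kernel-checked bookkeeping (leaf discharge + instance construction), NOT summit progress.
-/

namespace Literature.MathematicalPhysics.QuantumFieldTheory.Balaban1983to89.TreeLengthCubeSystem

noncomputable section

open Literature.MathematicalPhysics.QuantumFieldTheory.Balaban1983to89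
open Literature.MathematicalPhysics.QuantumFieldTheory.Balaban1983to89.B13ScaleTransfer
open Literature.MathematicalPhysics.QuantumFieldTheory.Balaban1983to89.TreeLength
open Literature.MathematicalPhysics.QuantumFieldTheory.Balaban1983to89.B12TreeDecay
open Literature.Probability.LatticeModels (IsRConnected)

variable {d : ℕ}

/-! ## Part 1. The localization domains of a finite window as a `LocDomainSys` and a `CubeSystem` -/

/-- X is a localization domain of the window B: a non-empty face-connected family of cubes of B ([Balaban1987RG1]
p. 257, as typed by `B13ScaleTransfer.FaceConnected`). [cite: Balaban1987RG1, §0 p.257] -/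
def IsDom (B X : Finset (Pt d)) : Prop := X ⊆ B ∧ X.Nonempty ∧ FaceConnected X

/-- The type of localization domains of the window B. [cite: Balaban1987RG1, §0 p.257] -/
def Dom (B : Finset (Pt d)) : Type := {X : Finset (Pt d) // IsDom B X}

/-- The localization domains of a finite window form a finite type. [folklore] -/
instance instFintypeDom (B : Finset (Pt d)) : Fintype (Dom B) := by
  classical
  exact Fintype.subtype (B.powerset.filter fun X => X.Nonempty ∧ FaceConnected X) fun X => by
    simp only [Finset.mem_filter, Finset.mem_powerset, IsDom]

/-- THE CONCRETE `LocDomainSys` OF A WINDOW: domains = the localization domains inside B, d_j := `treeLen` (≥ 0 by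
`treeLen_nonneg`). [cite: Balaban1987RG1, §0 p.257] -/
def sys (B : Finset (Pt d)) : LocDomainSys where
  Dom := Dom B
  dj := fun X => treeLen X.1
  dj_nonneg := fun X => treeLen_nonneg X.1

/-- The tree length of the concrete system is `treeLen`. [folklore] -/
@[simp] theorem sys_dj (B : Finset (Pt d)) (X : (sys B).Dom) : (sys B).dj X = treeLen X.1 := rfl

/-- The cubes of the window B (as a type). [cite: Balaban1987RG1, §0 p.257] -/
abbrev Cell (B : Finset (Pt d)) : Type := {x : Pt d // x ∈ B}

/-- The cubes of a family X ⊆ B, as elements of the window. [folklore] -/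
def cellsOf (B X : Finset (Pt d)) : Finset (Cell B) := Finset.univ.filter fun c => c.1 ∈ X

/-- Membership in `cellsOf`. [folklore] -/
@[simp] theorem mem_cellsOf {B X : Finset (Pt d)} {c : Cell B} : c ∈ cellsOf B X ↔ c.1 ∈ X := by
  simp [cellsOf]

/-- For X ⊆ B, `cellsOf B X` has exactly |X| elements. [folklore] -/
theorem card_cellsOf {B X : Finset (Pt d)} (hXB : X ⊆ B) : (cellsOf B X).card = X.card := by
  refine Finset.card_bij (fun c _ => c.1) (fun c hc => mem_cellsOf.1 hc) (fun a _ b _ h => Subtype.ext h) ?_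
  intro x hx
  exact ⟨⟨x, hXB hx⟩, mem_cellsOf.2 hx, rfl⟩

/-- `cellsOf B` is injective on subfamilies of B. [folklore] -/
theorem cellsOf_inj {B X Y : Finset (Pt d)} (hXB : X ⊆ B) (hYB : Y ⊆ B) (h : cellsOf B X = cellsOf B Y) :
    X = Y := by
  ext x
  constructor
  · intro hx
    have : (⟨x, hXB hx⟩ : Cell B) ∈ cellsOf B Y := h ▸ mem_cellsOf.2 hx
    exact mem_cellsOf.1 this
  · intro hx
    have : (⟨x, hYB hx⟩ : Cell B) ∈ cellsOf B X := h.symm ▸ mem_cellsOf.2 hx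
    exact mem_cellsOf.1 this

/-- The wall-neighbours of a cube inside the window. [folklore] -/
def nbr (B : Finset (Pt d)) (a : Cell B) : Finset (Cell B) := by
  classical
  exact Finset.univ.filter fun b => Adj a.1 b.1

/-- Membership in `nbr`. [folklore] -/
@[simp] theorem mem_nbr {B : Finset (Pt d)} {a b : Cell B} : b ∈ nbr B a ↔ Adj a.1 b.1 := by
  classical
  simp [nbr]

/-- Transport of chain-connectedness: a chain of wall-adjacent cubes inside X ⊆ B is a chain in the window relation
restricted to `cellsOf B X`. [folklore] -/
theorem linked_lift {B X : Finset (Pt d)} (hXB : X ⊆ B) {x y : Pt d} (hx : x ∈ B) (h : Linked X x y) :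
    ∀ hy : y ∈ B, Relation.ReflTransGen
      (fun a b : Cell B => Adj a.1 b.1 ∧ a ∈ cellsOf B X ∧ b ∈ cellsOf B X) ⟨x, hx⟩ ⟨y, hy⟩ := by
  unfold Linked at h
  induction h with
  | refl => intro hy; exact Relation.ReflTransGen.refl
  | tail _ hbc ih =>
    intro hy
    obtain ⟨hb, hc, hadj⟩ := hbc
    exact Relation.ReflTransGen.tail (ih (hXB hb)) ⟨hadj, mem_cellsOf.2 hb, mem_cellsOf.2 hc⟩

/-- A localization domain of the window is `IsRConnected` for the window adjacency (the connectedness field of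
`CubeSystem`). [cite: Balaban1987RG1, §0 p.257] -/
theorem isRConnected_cellsOf {B : Finset (Pt d)} (X : Dom B) :
    IsRConnected (fun a b : Cell B => Adj a.1 b.1) (cellsOf B X.1) := by
  obtain ⟨hXB, ⟨x, hx⟩, hconn⟩ := X.2
  refine ⟨⟨⟨x, hXB hx⟩, mem_cellsOf.2 hx⟩, ?_⟩
  intro v hv w hw
  have h := linked_lift hXB v.2 (hconn v.1 (mem_cellsOf.1 hv) w.1 (mem_cellsOf.1 hw)) w.2
  exact h

/-- THE CONCRETE `CubeSystem` OF A WINDOW over `sys B`: cubes = elements of B, adjacency = common wall, neighbour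
lists, cubes of a domain = its members, connectedness from `FaceConnected`. [cite: Balaban1987RG1, §0 p.257] -/
def cubeSys (B : Finset (Pt d)) : CubeSystem (sys B) where
  Cube := Cell B
  Adj := fun a b => Adj a.1 b.1
  adj_symm := fun _ _ h => h.symm
  nbr := nbr B
  mem_nbr := fun _ _ h => mem_nbr.2 h
  cubes := fun X => cellsOf B X.1
  cubes_injective := fun X Y h => Subtype.ext (cellsOf_inj X.2.1 Y.2.1 h)
  connected := fun X => isRConnected_cellsOf X

/-- The cubes of a domain in the concrete system are its members. [folklore] -/
@[simp] theorem cubeSys_cubes (B : Finset (Pt d)) (X : (sys B).Dom) : (cubeSys B).cubes X = cellsOf B X.1 := rfl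

/-- The volume |X|_M of a domain in the concrete system is its number of cubes. [folklore] -/
theorem cubeSys_vol (B : Finset (Pt d)) (X : (sys B).Dom) : (cubeSys B).vol X = X.1.card := by
  show (cellsOf B X.1).card = X.1.card
  exact card_cellsOf X.2.1

/-! ## Part 2. The two geometric inputs of `B12TreeDecay`, PROVED for the window system -/

/-- The 2d candidate wall-neighbours of a cube x of ℤ^d: x ± e_i. [folklore] -/
def shift (x : Pt d) (p : Fin d × Bool) : Pt d :=
  Function.update x p.1 (x p.1 + if p.2 then 1 else -1)

/-- Every wall-neighbour of x is one of the 2d shifts x ± e_i. [folklore] -/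
theorem exists_shift_of_adj {x y : Pt d} (h : Adj x y) : ∃ p : Fin d × Bool, y = shift x p := by
  obtain ⟨i, h | h⟩ := h
  · exact ⟨(i, true), by simp [shift, h]⟩
  · refine ⟨(i, false), ?_⟩
    funext j
    by_cases hj : j = i
    · subst hj
      have := congrFun h j
      simp only [Function.update_self] at this
      simp only [shift, Function.update_self]
      simp only [Bool.false_eq_true, ↓reduceIte]
      linarith
    · have := congrFun h j
      simp only [Function.update_of_ne hj] at this
      simp only [shift, Function.update_of_ne hj]
      exact this.symm

/-- DEGREE BOUND, PROVED: every cube of the window has at most 2d wall-neighbours in it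
(`B12TreeDecay.CubeSystem.DegreeLE (2 * d)`; [Dimock2013] App. A counts paths *"by (2^d)^{2(n−1)}"*). [cite: Dimock2013, App. A Lemma 25 proof (arXiv:1108.1335v2 TeX L3119–3120)] -/
theorem degreeLE (B : Finset (Pt d)) : (cubeSys B).DegreeLE (2 * d) := by
  classical
  intro a
  show (nbr B a).card ≤ 2 * d
  have hsub : (nbr B a).map (Function.Embedding.subtype _) ⊆ Finset.univ.image (shift a.1) := by
    intro y hy
    rw [Finset.mem_map] at hy
    obtain ⟨b, hb, rfl⟩ := hy
    obtain ⟨p, hp⟩ := exists_shift_of_adj (mem_nbr.1 hb)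
    exact Finset.mem_image.2 ⟨p, Finset.mem_univ _, hp.symm⟩
  calc (nbr B a).card = ((nbr B a).map (Function.Embedding.subtype _)).card := (Finset.card_map _).symm
    _ ≤ (Finset.univ.image (shift a.1)).card := Finset.card_le_card hsub
    _ ≤ (Finset.univ : Finset (Fin d × Bool)).card := Finset.card_image_le
    _ = 2 * d := by simp [Finset.card_univ, mul_comm]

/-- THE VOLUME LEAF, PROVED: |X| ≤ 4·2^d (1 + d_j(X)) for every localization domain of the window
(`B12TreeDecay.CubeSystem.VolumeLeaf (4 * 2 ^ d)`), from `TreeLength.card_le_treeLen` (|X| ≤ 2^d(4 d_j(X) + 1),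
the repaired lower half of [Balaban1988RG2Cluster] (2.30) p. 18, cell GAPS.md G-B13-07 / C-pv22-2). [cite: Balaban1988RG2Cluster, (2.30) p.18 (lower half, repaired form)] -/
theorem volumeLeaf (B : Finset (Pt d)) : (cubeSys B).VolumeLeaf (4 * 2 ^ d) := by
  intro X
  rw [cubeSys_vol, sys_dj]
  have h := card_le_treeLen X.2.2.1 X.2.2.2
  have h2 : (0 : ℝ) ≤ 2 ^ d := by positivity
  nlinarith

/-! ## Part 3. (1.26), `hTree` and (2.29) for `treeLen`, unconditionally -/

/-- **[Balaban1988RG2Cluster] (1.26) p. 8 FOR THE FORMALISED d_j, NO HYPOTHESES ON THE GEOMETRY**: for every window B,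
every κ ≥ κ₀(4·2^d, 2d) and every cube □′ of B, Σ_{X ∈ 𝐃(B), X ∋ □′} exp(−κ d_j(X)) ≤ K₀(4·2^d, 2d) — the constants
of `B12TreeDecay` at c₀ = 4·2^d, Δ = 2d, depending on d only. Application of unit pv03's `ineq126_of_volumeLeaf` to
`degreeLE`, `volumeLeaf`. [cite: Balaban1988RG2Cluster, (1.26) p.8] -/
theorem ineq126_treeLen (B : Finset (Pt d)) {κ : ℝ} (hκ : kappa₀ (4 * 2 ^ d) (2 * d) ≤ κ) :
    (cubeSys B).Ineq126Printed κ (K₀ (4 * 2 ^ d) (2 * d)) :=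
  ineq126_of_volumeLeaf (cubeSys B) (degreeLE B) (volumeLeaf B) hκ

/-- (1.26) for `treeLen` spelled out over plain finite sets: for every window B, every cube □′ ∈ B and every
κ ≥ κ₀(4·2^d, 2d), the sum of exp(−κ·treeLen X) over the non-empty face-connected X ⊆ B containing □′ is
≤ K₀(4·2^d, 2d). [cite: Balaban1988RG2Cluster, (1.26) p.8] -/
theorem sum_exp_treeLen_le (B : Finset (Pt d)) {c : Pt d} (hc : c ∈ B) {κ : ℝ}
    (hκ : kappa₀ (4 * 2 ^ d) (2 * d) ≤ κ) [DecidablePred fun X : Finset (Pt d) => c ∈ X ∧ FaceConnected X] :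
    ∑ X ∈ B.powerset.filter (fun X => c ∈ X ∧ FaceConnected X), Real.exp (-κ * treeLen X)
      ≤ K₀ (4 * 2 ^ d) (2 * d) := by
  classical
  have h := ineq126_treeLen B hκ ⟨c, hc⟩
  -- transport the sum over `(cubeSys B).above ⟨c, hc⟩ : Finset (Dom B)` to plain finite sets
  have heq : ∑ X ∈ (cubeSys B).above ⟨c, hc⟩, Real.exp (-κ * (sys B).dj X)
      = ∑ X ∈ B.powerset.filter (fun X => c ∈ X ∧ FaceConnected X), Real.exp (-κ * treeLen X) := by
    refine Finset.sum_bij (fun X _ => X.1) ?_ ?_ ?_ ?_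
    · intro X hX
      rw [CubeSystem.mem_above, cubeSys_cubes] at hX
      rw [Finset.mem_filter, Finset.mem_powerset]
      exact ⟨X.2.1, mem_cellsOf.1 hX, X.2.2.2⟩
    · intro X _ Y _ h
      exact Subtype.ext h
    · intro Y hY
      rw [Finset.mem_filter, Finset.mem_powerset] at hY
      refine ⟨⟨Y, hY.1, ⟨c, hY.2.1⟩, hY.2.2⟩, ?_, rfl⟩
      rw [CubeSystem.mem_above, cubeSys_cubes]
      exact mem_cellsOf.2 hY.2.1
    · intro X _
      rfl
  rw [← heq]
  exact h

/-- The silent input `hTree` of [Balaban1987RG1] (0.26)/(0.30) (surge node T09.1, `B12.chain026_holds` /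
`chain030_holds`; cell GAPS.md G-pv03-1) for the cover induced by the window system, DISCHARGED outright:
`∀ □, Σ_{X ∈ above □} exp(−κ d_j(X)) ≤ K₀` for κ ≥ κ₀. [cite: Balaban1987RG1, (0.26) p.257 and (0.30) p.258] -/
theorem hTree_treeLen (B : Finset (Pt d)) {κ : ℝ} (hκ : kappa₀ (4 * 2 ^ d) (2 * d) ≤ κ) :
    ∀ c : (cubeSys B).toCubeCover.Cube,
      ∑ X ∈ (cubeSys B).toCubeCover.above c, Real.exp (-κ * (sys B).dj X) ≤ K₀ (4 * 2 ^ d) (2 * d) :=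
  hTree_of_volumeLeaf (cubeSys B) (degreeLE B) (volumeLeaf B) hκ

/-- The multi-scale form of `hTree` for a family of windows (one per scale), same constants at every scale. [cite: Balaban1987RG1, (0.26) p.257 and (0.30) p.258] -/
theorem hTree_scales_treeLen (k : ℕ) (B : ℕ → Finset (Pt d)) {κ : ℝ} (hκ : kappa₀ (4 * 2 ^ d) (2 * d) ≤ κ) :
    ∀ j ∈ Finset.Icc 1 k, ∀ c : (cubeSys (B j)).toCubeCover.Cube,
      ∑ X ∈ (cubeSys (B j)).toCubeCover.above c, Real.exp (-κ * (sys (B j)).dj X) ≤ K₀ (4 * 2 ^ d) (2 * d) :=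
  hTree_scales_of_volumeLeaf k (fun j => sys (B j)) (fun j => cubeSys (B j)) (fun j => degreeLE (B j))
    (fun j => volumeLeaf (B j)) hκ

/-- **[Balaban1988RG2Cluster] (2.29) p. 18 FOR THE FORMALISED d_k, NO HYPOTHESES ON THE GEOMETRY**: for every window B,
with c₀ = 4·2^d, Δ = 2d and the smallness conditions of `B12TreeDecay.ineq229_of_volumeLeaf` (α₆ ≥ 0, a₂ ≥ 0,
δκ ≥ κ₀(c₀, Δ) + a₂, α₆ e^{a₂} K₀(c₀, Δ) c₀ ≤ a₂): Σ_𝐃 Π_{Y∈𝐃} α₆ exp(−δκ d_k(Y)) ≤ 1 for EVERY Y₀, the sum over the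
families 𝐃 of different localization domains of the window with ∪𝐃 = Y₀ (`B13FamilySum.Ineq229`, unit pv18).
[cite: Balaban1988RG2Cluster, (2.29) p.18] -/
theorem ineq229_treeLen (B : Finset (Pt d)) (δ κ α₆ a₂ : ℝ) (hα₆ : 0 ≤ α₆) (ha₂ : 0 ≤ a₂)
    (hκ : kappa₀ (4 * 2 ^ d) (2 * d) + a₂ ≤ δ * κ)
    (hsmall : α₆ * Real.exp a₂ * K₀ (4 * 2 ^ d) (2 * d) * (4 * 2 ^ d) ≤ a₂) :
    B13FamilySum.Ineq229 (Finset.univ : Finset (sys B).Dom) (cubeSys B).cubes (sys B).dj α₆ (δ * κ) :=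
  ineq229_of_volumeLeaf (cubeSys B) (degreeLE B) (by positivity) (volumeLeaf B) δ κ α₆ a₂ hα₆ ha₂ hκ hsmall

/-- The unit instance of (2.29) (a₂ = 1): δκ ≥ κ₀(4·2^d, 2d) + 1 and e·K₀(4·2^d, 2d)·4·2^d·α₆ ≤ 1 suffice — "κ
sufficiently large and α₆ sufficiently small", both thresholds depending on d only. [cite: Balaban1988RG2Cluster, (2.29) p.18] -/
theorem ineq229_treeLen_unit (B : Finset (Pt d)) (δ κ α₆ : ℝ) (hα₆ : 0 ≤ α₆)
    (hκ : kappa₀ (4 * 2 ^ d) (2 * d) + 1 ≤ δ * κ)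
    (hsmall : Real.exp 1 * K₀ (4 * 2 ^ d) (2 * d) * (4 * 2 ^ d) * α₆ ≤ 1) :
    B13FamilySum.Ineq229 (Finset.univ : Finset (sys B).Dom) (cubeSys B).cubes (sys B).dj α₆ (δ * κ) :=
  ineq229_of_volumeLeaf_unit (cubeSys B) (degreeLE B) (by positivity) (volumeLeaf B) δ κ α₆ hα₆ hκ hsmall

/-- d = 4: the thresholds are κ₀ = 64 · log 162 (c₀ = 64, Δ = 8, a₀ = log(2·9²)) and K₀ = e^{κ₀}/81. [folklore] -/
theorem kappa₀_four : kappa₀ (4 * 2 ^ 4) (2 * 4) = 64 * Real.log 162 := by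
  simp only [kappa₀, a₀]
  norm_num


/-! ## Part 4. The polymer-geometry HYPOTHESIS structure of `B13Resummation` (unit pv18, G-B13-11 kernel), CONSTRUCTED -/

/-- The incompatibility of the polymer gas (2.11): *"ζ(Z, Z′) = 0 if Z ∩ Z′ contains a cube, or a wall of a cube"*
(as quoted in `B13Resummation.Geometry`) — the footprints share a cube or a pair of wall-adjacent cubes. [cite: Balaban1988RG2Cluster, (2.11) p.14] -/
def Touch (B : Finset (Pt d)) (Z Z' : Dom B) : Prop :=
  ∃ a ∈ cellsOf B Z.1, ∃ b ∈ cellsOf B Z'.1, a = b ∨ Adj a.1 b.1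

/-- `Touch` is reflexive (a domain has a cube). [folklore] -/
theorem touch_refl (B : Finset (Pt d)) (Z : Dom B) : Touch B Z Z := by
  obtain ⟨a, ha⟩ := (isRConnected_cellsOf Z).1
  exact ⟨a, ha, a, ha, Or.inl rfl⟩

/-- `Touch` is symmetric. [folklore] -/
theorem touch_symm (B : Finset (Pt d)) (Z Z' : Dom B) (h : Touch B Z Z') : Touch B Z' Z := by
  obtain ⟨a, ha, b, hb, hab⟩ := h
  refine ⟨b, hb, a, ha, ?_⟩
  rcases hab with hab | hab
  · exact Or.inl hab.symm
  · exact Or.inr hab.symm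

/-- The reach of a domain: its cubes and the cubes of the window sharing a wall with one of them. [cite: Balaban1988RG2Cluster, (2.11) p.14] -/
def reach (B : Finset (Pt d)) (Z : Dom B) : Finset (Cell B) := by
  classical
  exact Finset.univ.filter fun q => ∃ a ∈ cellsOf B Z.1, q = a ∨ Adj a.1 q.1

/-- Membership in `reach`. [folklore] -/
theorem mem_reach {B : Finset (Pt d)} {Z : Dom B} {q : Cell B} :
    q ∈ reach B Z ↔ ∃ a ∈ cellsOf B Z.1, q = a ∨ Adj a.1 q.1 := by
  classical
  simp [reach]

/-- Footprint-locality of the incompatibility through the reach (`B13Resummation.Geometry.loc`). [folklore] -/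
theorem loc_of_touch {B : Finset (Pt d)} {Z Z' : Dom B} (h : Touch B Z' Z) :
    ∃ q ∈ reach B Z, q ∈ cellsOf B Z'.1 := by
  obtain ⟨a, ha, b, hb, hab⟩ := h
  refine ⟨a, mem_reach.2 ⟨b, hb, ?_⟩, ha⟩
  rcases hab with hab | hab
  · exact Or.inl hab
  · exact Or.inr hab.symm

/-- `#reach Z ≤ (2d + 1) · #cubes Z` (`B13Resummation.Geometry.reach_le` with ν = 2d + 1), from the degree bound. [folklore] -/
theorem card_reach_le (B : Finset (Pt d)) (Z : Dom B) :
    ((reach B Z).card : ℝ) ≤ (2 * (d : ℝ) + 1) * ((cellsOf B Z.1).card : ℝ) := by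
  classical
  have hsub : reach B Z ⊆ (cellsOf B Z.1).biUnion fun a => insert a (nbr B a) := by
    intro q hq
    obtain ⟨a, ha, hqa⟩ := mem_reach.1 hq
    rw [Finset.mem_biUnion]
    refine ⟨a, ha, ?_⟩
    rcases hqa with rfl | hqa
    · exact Finset.mem_insert_self _ _
    · exact Finset.mem_insert_of_mem (mem_nbr.2 hqa)
  have h1 : (reach B Z).card ≤ ∑ a ∈ cellsOf B Z.1, (insert a (nbr B a)).card :=
    (Finset.card_le_card hsub).trans Finset.card_biUnion_le
  have h2 : ∀ a ∈ cellsOf B Z.1, (insert a (nbr B a)).card ≤ 2 * d + 1 := fun a _ =>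
    (Finset.card_insert_le _ _).trans (by have := degreeLE B a; change (nbr B a).card ≤ 2 * d at this; omega)
  have h3 : (reach B Z).card ≤ (2 * d + 1) * (cellsOf B Z.1).card := by
    refine h1.trans ?_
    rw [mul_comm]
    exact Finset.sum_le_card_nsmul _ _ _ h2 |>.trans (by simp [smul_eq_mul])
  have h4 : ((reach B Z).card : ℝ) ≤ (((2 * d + 1) * (cellsOf B Z.1).card : ℕ) : ℝ) := by exact_mod_cast h3
  simpa using h4

/-- (2.27) with its printed constant 5 for the covering families of the window system (`B13Resummation.Geometry.ineq227`),
from `TreeLength.ineq227_treeLen`: for every domain X and every family 𝐃 of domains of the window whose cubes cover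
exactly the cubes of X, d_k(X) + 5 ≤ Σ_{Y∈𝐃}(d_k(Y) + 5). [cite: Balaban1988RG2Cluster, (2.27) p.18] -/
theorem ineq227_cells (B : Finset (Pt d)) (X : Dom B) :
    B13FamilySum.Ineq227 (Finset.univ : Finset (sys B).Dom) (fun Y : Dom B => cellsOf B Y.1) (sys B).dj
      (cellsOf B X.1) (treeLen X.1) 5 := by
  classical
  intro D hD
  rw [B13FamilySum.mem_coveringFamilies] at hD
  obtain ⟨-, hU⟩ := hD
  set D' : Finset (Finset (Pt d)) := D.image (fun Y : Dom B => Y.1) with hD'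
  have hsubB : D'.biUnion id ⊆ B := by
    intro x hx
    rw [Finset.mem_biUnion] at hx
    obtain ⟨Y, hY, hxY⟩ := hx
    rw [Finset.mem_image] at hY
    obtain ⟨Z, _, rfl⟩ := hY
    exact Z.2.1 hxY
  have hcells : cellsOf B (D'.biUnion id) = cellsOf B X.1 := by
    rw [← hU]
    ext c
    rw [mem_cellsOf, Finset.mem_biUnion, Finset.mem_biUnion]
    constructor
    · rintro ⟨Y, hY, hc⟩
      obtain ⟨Z, hZ, rfl⟩ := Finset.mem_image.1 hY
      exact ⟨Z, hZ, mem_cellsOf.2 hc⟩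
    · rintro ⟨Z, hZ, hc⟩
      exact ⟨Z.1, Finset.mem_image.2 ⟨Z, hZ, rfl⟩, mem_cellsOf.1 hc⟩
  have hUnion : D'.biUnion id = X.1 := cellsOf_inj hsubB X.2.1 hcells
  have hDne : D.Nonempty := by
    obtain ⟨x, hx⟩ := X.2.2.1
    have hc : (⟨x, X.2.1 hx⟩ : Cell B) ∈ D.biUnion (fun Y : Dom B => cellsOf B Y.1) := by
      rw [hU]; exact mem_cellsOf.2 hx
    obtain ⟨Y, hY, -⟩ := Finset.mem_biUnion.1 hc
    exact ⟨Y, hY⟩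
  have hD'ne : D'.Nonempty := hDne.image _
  have hmem : ∀ Y ∈ D', Y.Nonempty ∧ FaceConnected Y := by
    intro Y hY
    obtain ⟨Z, _, rfl⟩ := Finset.mem_image.1 hY
    exact ⟨Z.2.2.1, Z.2.2.2⟩
  have hUc : FaceConnected (D'.biUnion id) := by rw [hUnion]; exact X.2.2.2
  have h := ineq227_treeLen hD'ne hmem hUc
  rw [hUnion] at h
  have hinj : ∀ Z ∈ D, ∀ W ∈ D, (fun Y : Dom B => Y.1) Z = (fun Y : Dom B => Y.1) W → Z = W :=
    fun Z _ W _ hZW => Subtype.ext hZW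
  have hsum : ∑ Y ∈ D', (treeLen Y + 5) = ∑ Y ∈ D, (treeLen Y.1 + 5) := by
    rw [hD']
    exact Finset.sum_image hinj
  rw [hsum] at h
  simpa using h

/-- **THE POLYMER GEOMETRY OF 𝐃_{k+1}, CONSTRUCTED** (`B13Resummation.Geometry`, unit pv18's HYPOTHESIS structure of the
G-B13-11 kernel — *"an instance is to be constructed by the joiner from the concrete lattice geometry"*): for the window
system, footprints = `cellsOf`, incompatibility = `Touch`, reach = `reach`, ν = 2d + 1, κ₀ = κ₀(4·2^d, 2d),
K₀ = K₀(4·2^d, 2d), c₁ = 4·2^d, and ALL its inequality fields — (1.26) at rate κ₀, the additive volume bound, (2.27) with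
constant 5 — PROVED.  Consequently `B13Resummation.cammarotaStepWith_of_KP S c ℓ (geometry B)` (for step data with
𝐃_{k+1} = `sys B`) retains only its analytic hypotheses (`SpRestr`, `Repr213`) and numerical smallness conditions.
[cite: Balaban1988RG2Cluster, (2.11) p.14] -/
def geometry (B : Finset (Pt d)) : B13Resummation.Geometry (sys B) (Cell B) where
  cubes := fun X => cellsOf B X.1
  reach := reach B
  ι := Touch B
  ν := 2 * (d : ℝ) + 1
  κ₀ := kappa₀ (4 * 2 ^ d) (2 * d)
  K₀ := B12TreeDecay.K₀ (4 * 2 ^ d) (2 * d)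
  c₁ := 4 * 2 ^ d
  cubes_nonempty := fun X => (isRConnected_cellsOf X).1
  ι_refl := touch_refl B
  ι_symm := touch_symm B
  loc := fun _ _ h => loc_of_touch h
  reach_le := card_reach_le B
  ν_nonneg := by positivity
  κ₀_nonneg := kappa₀_nonneg (by positivity) _
  K₀_nonneg := (K₀_pos _ _).le
  c₁_nonneg := by positivity
  ineq126 := familySum_ineq126_of_volumeLeaf (cubeSys B) (degreeLE B) (volumeLeaf B) le_rfl
  volBound := (familySum_volBound_iff (cubeSys B) _).2 (volumeLeaf B)
  ineq227 := ineq227_cells B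

/-- The constants of the constructed geometry (for the smallness conditions of `B13Resummation.cammarotaStepWith_of_KP`):
ν = 2d + 1, κ₀ = κ₀(4·2^d, 2d), K₀ = K₀(4·2^d, 2d), c₁ = 4·2^d. [folklore] -/
theorem geometry_consts (B : Finset (Pt d)) :
    (geometry B).ν = 2 * (d : ℝ) + 1 ∧ (geometry B).κ₀ = kappa₀ (4 * 2 ^ d) (2 * d) ∧
      (geometry B).K₀ = B12TreeDecay.K₀ (4 * 2 ^ d) (2 * d) ∧ (geometry B).c₁ = 4 * 2 ^ d :=
  ⟨rfl, rfl, rfl, rfl⟩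

end

end Literature.MathematicalPhysics.QuantumFieldTheory.Balaban1983to89.TreeLengthCubeSystem
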